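import Summits.PneNP.PneNP.Theorems.PhaseTwinsNoFBPPApproxAboveUniquenessCounterSpec
import Summits.PneNP.PneNP.Theorems.PhaseTwinsNoFBPPApproxAboveUniquenessTtFnEqAdFn
import Summits.PneNP.PneNP.Theorems.PhaseTwinsNoFBPPApproxAboveUniquenessAccFEighth
import Summits.PneNP.PneNP.Theorems.PhaseTwinsNoFBPPApproxAboveUniquenessCoinSplit
import Summits.PneNP.PneNP.Theorems.PhaseTwinsNoFBPPApproxAboveUniquenessLeverAssembly

/-!
# The lever of line `SketchIdeator1` (crux stmt-PneNP-2717): `NP ⊆ BPP →` every `#P` function has an FPRAS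

Oracle-free Stockmeyer ("`BPP^BPP = BPP`" inside the approximate counter), assembled from the line's landed
stubs S0 `stub_counter_spec`, S1 `stub_ttFn_eq_adFn`, S2 `stub_exists_accF_good_eighth`, S3 `stub_coinSplit`
and the assembly step S4′ `stub_leverAssembly`; confidence amplified by Jerrum–Valiant–Vazirani powering
(`ThreeQuartersFPRAS.hasFPRAS`, proved in the tree). This is the `⟸`-half of the calibration
`NoFBPPApproxAboveUniqueness ⟺ ¬(NP ⊆ BPP)`: together with `HardcoreCountSharpP` it gives Theorem N
`NP ⊆ BPP → ¬ NoFBPPApproxAboveUniqueness`.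
-/

set_option linter.dupNamespace false

namespace Summit.PneNP.PneNP.Theorems.NoFBPPApproxAboveUniqueness

open Literature.Computability.Complexity

/-- **`NP ⊆ BPP →` every `#P` function has a textbook `3/4`-FPRAS.**
[cite: AroraBarak2009, §7.5.2 (BPP^BPP = BPP) with §17.1] -/
theorem threeQuartersFPRAS_of_sharpP_of_NP_subset_BPP (hNP : Nondeterministic.NP ⊆ BPP)
    {N : List Bool → ℕ} (hN : N ∈ SharpP) : ThreeQuartersFPRAS N :=
  stub_leverAssembly stub_counter_spec stub_ttFn_eq_adFn (fun hA _ hQ q => stub_exists_accF_good_eighth hA hQ q)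
    (fun rp c₁ T k₀ _ hH => stub_coinSplit rp c₁ T k₀ hH) hNP hN

/-- **The lever (registered sub-goal `lever_hasFPRAS_of_NP_subset_BPP`).** If `NP ⊆ BPP` then every `#P`
function has an FPRAS with confidence parameter. [cite: JerrumValiantVazirani1986, Lemma 6.1] -/
theorem lever_hasFPRAS_of_NP_subset_BPP : Nondeterministic.NP ⊆ BPP → ∀ N : List Bool → ℕ, N ∈ SharpP → HasFPRAS N :=
  fun hNP _ hN => (threeQuartersFPRAS_of_sharpP_of_NP_subset_BPP hNP hN).hasFPRAS

/-- **The lever**, implicit-argument form. [cite: JerrumValiantVazirani1986, Lemma 6.1] -/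
theorem hasFPRAS_of_sharpP_of_NP_subset_BPP (hNP : Nondeterministic.NP ⊆ BPP) {N : List Bool → ℕ}
    (hN : N ∈ SharpP) : HasFPRAS N :=
  lever_hasFPRAS_of_NP_subset_BPP hNP N hN

end Summit.PneNP.PneNP.Theorems.NoFBPPApproxAboveUniqueness
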